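import Literature.AlgebraicGeometry.GroupSchemes.CartierDualBidualNatural
import Literature.AlgebraicGeometry.GroupSchemes.AffineGroupSchemeIsoSpec
import Literature.RingTheory.HopfAlgebra.FiniteDualHopfAlgebra
import HarnessLib

/-!
# Cartier duality is additive: `(f·g)^D = f^D·g^D`, `(𝟙_G^n)^D = 𝟙_{G^D}^n`, and `G` is killed by `n` iff `G^D` is (Tate 1997 §(3.8))

Layer `Literature/AlgebraicGeometry/GroupSchemes`, namespace `Literature.AlgebraicGeometry.GroupSchemes.AffineGroupScheme` (continues ★ `CartierDualMap`
p845343 — `cartierDualMap`, `DualAlg.transpose`, `coord_comp_cartierDualMap`, `cartierDualMap_comp ∕ _id` —, ★ `CartierDualBidualNatural` p845987 ∕ p846030 —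
naturality of `ε_G : (G^D)^D ≅ G`, `cartierDualMap_of_eq_one` —, ★ `AffineGroupSchemeHopfAlgebra` ∕ `AffineGroupSchemeIsoSpec` — `ptMulEquiv`,
`comap_eq_ptEquiv` —, ★ `AffineGroupSchemeOfHopfAlgebra` — `coord_mul_eq` —, ★ `FiniteDualHopfAlgebra` — `evalTwo`, `evalTwo_comul_eq` —).  THEOREMS ONLY
(no definition, no instance, no notation, no named fact, no `sorry`).  Cell `hodgecm-mathlib` (D-0151), programme P6 «MOD», organ (ADD) of B-p04 (g38):
additivity of the Cartier-duality dictionary — the input that lets a RING action `a ↦ ι(a)` on `G` transpose to the ring action `a ↦ ι(a)^D` on `G^D`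
(HEART-FROB §B: `𝒢^D[ϖ̄]`, `[ϖ̄^{d−1}]⁻¹(C₀^⊥)`), and that moves «killed by `p^t`» between `G` and `G^D` (★ `DiagonalizableOfEtaleCartierDual`).
Count-neutral Mathlib-side capital: HC_CM is proved only modulo the printed citations until rung 0 closes; nothing here bears on it.

THE PRINT ([Tate1997FiniteFlatGroupSchemes] §(3.8) p. 145: `G^D(S) = Hom_{S-gr}(G_S, 𝔾_{m,S})` is a GROUP functorially in `G`, i.e. `G ↦ G^D` is an
additive (contravariant) functor on finite flat commutative group schemes; [GortzWedhorn2023] (27.2.1): the group law on points `Hom(T, G)` is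
convolution of algebra maps `Γ(G) → Γ(T)`).  For finite free commutative affine group objects `G₁ G₂ G` of `SchemeOver R` and homomorphisms
`f g : G₁ ⟶ G₂` (their pointwise product `f·g = lift f g ≫ μ` is again a homomorphism because `G₂` is commutative, `isMonHom_mul`):

* §1 POINTS MULTIPLY BY CONVOLUTION ON ALGEBRAS: `Alg.comap_mul : Γ(f·g) = Γ(f) ⋆ Γ(g)` (any affine `W ⟶ G`, ★ `comap_eq_ptEquiv` + ★ `ptMulEquiv`),
  `Alg.comap_pow`, `isMonHom_mul`, `isMonHom_id_pow`.
* §2 THE TRANSPOSE IS MULTIPLICATIVE FOR CONVOLUTION: **`DualAlg.transpose_mul : (Γ(f·g))^* = (Γ(f))^* ⋆ (Γ(g))^*`** in the convolution monoid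
  `WithConv (Γ(G₁)^* →ₐ Γ(G₂)^*)` — evaluate both sides at `ν ∈ Γ(G₁)^*`, `a ∈ Γ(G₂)`: both give `ν(Σ f^*(a₁) g^*(a₂))` (★ `evalTwo_comul_eq`: `Δ^*ν = ν ∘ m`).
* §3 HEAD **`cartierDualMap_mul : (f·g)^D = f^D · g^D`** (★ `coord_injective`, ★ `coord_mul_eq`, Mathlib `AlgHom.comp_convMul_distrib`), `cartierDualMap_id_pow :
  ((𝟙 G)^n)^D = (𝟙 G^D)^n`, and **`id_pow_cartierDual_eq_one_iff : (𝟙 G^D)^n = 1 ↔ (𝟙 G)^n = 1`** («`G` is killed by `n` iff `G^D` is»; biduality for `←`).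
* §4 THE DUAL OF A RING ACTION `ι' : O → (G ⟶ G)` (laws as hypotheses, `O` commutative): `cartierDualMap_action_add ∕ _mul ∕ _one ∕ _zero ∕ _eq_one_iff` —
  `a ↦ ι'(a)^D` satisfies the same laws on `G^D`, and `a` kills `G` iff it kills `G^D`.

## References
* [Tate1997FiniteFlatGroupSchemes] J. Tate, *Finite flat group schemes*, in: Modular Forms and Fermat's Last Theorem (1997), §(3.8) p. 145.
* [GortzWedhorn2023] U. Görtz, T. Wedhorn, *Algebraic Geometry II* (2023), §(27.2) (27.2.1) (pp. 606–607).
-/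

set_option autoImplicit false

-- Mathlib's `Over`/`Scheme` APIs are stated across semireducible wrappers (as in the ★ `GroupSchemes/*` files).
set_option backward.isDefEq.respectTransparency false

universe u

open CategoryTheory CategoryTheory.Limits AlgebraicGeometry MonoidalCategory CartesianMonoidalCategory TensorProduct WithConv

noncomputable section

namespace Literature.AlgebraicGeometry.GroupSchemes

namespace AffineGroupScheme

open scoped MonObj

open Literature.AlgebraicGeometry.Motives Literature.NumberTheory.DiophantineGeometry Literature.RingTheory.HopfAlgebra

variable {R : Type u} [CommRing R]

/-! ## §1 Points multiply by convolution on algebras -/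

section Comap

variable (G : SchemeOver R) [GrpObj G] [IsAffine G.left] {W : SchemeOver R} [IsAffine W.left] (f g : W ⟶ G)

/-- **`Γ(f·g) = Γ(f) ⋆ Γ(g)`**: the algebra map of the pointwise product of two `W`-points of the affine group scheme `G` is the CONVOLUTION of their algebra
maps (★ `comap_eq_ptEquiv`: `Γ(w)` is the algebra map of the point `Spec Γ(W) ≅ W → G`; ★ `ptMulEquiv`: points multiply by convolution).
[cite: GortzWedhorn2023, §(27.2) (27.2.1) (pp. 606–607)] -/
theorem Alg.comap_mul : Alg.comap (f * g) = ((toConv (Alg.comap f) : WithConv (Alg G →ₐ[R] Alg W)) * toConv (Alg.comap g)).ofConv := by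
  rw [comap_eq_ptEquiv, MonObj.comp_mul, ← ofConv_toConv (ptEquiv G (Alg W) _), ← ptMulEquiv_apply, map_mul, ptMulEquiv_apply, ptMulEquiv_apply,
    ← comap_eq_ptEquiv, ← comap_eq_ptEquiv]

/-- **`Γ(f^n) = Γ(f)^{⋆n}`.** [cite: GortzWedhorn2023, §(27.2) (27.2.1) (pp. 606–607)] -/
theorem Alg.comap_pow (n : ℕ) : Alg.comap (f ^ n) = ((toConv (Alg.comap f) : WithConv (Alg G →ₐ[R] Alg W)) ^ n).ofConv := by
  rw [comap_eq_ptEquiv, MonObj.comp_pow, ← ofConv_toConv (ptEquiv G (Alg W) _), ← ptMulEquiv_apply, map_pow, ptMulEquiv_apply, ← comap_eq_ptEquiv]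

omit [IsAffine G.left] [IsAffine W.left] in
/-- For a COMMUTATIVE group object the pointwise product of two homomorphisms is a homomorphism (Mathlib: `lift f g ≫ μ` is one).
[cite: GortzWedhorn2023, §(27.2) (27.2.1) (pp. 606–607)] -/
theorem isMonHom_mul [IsCommMonObj G] [MonObj W] [IsMonHom f] [IsMonHom g] : IsMonHom (f * g) := by
  rw [Hom.mul_def]; infer_instance

omit [IsAffine G.left] in
/-- `(𝟙 G)^n : G → G`, the `n`-th power map, is a homomorphism for commutative `G`. [cite: GortzWedhorn2023, §(27.2) (27.2.1) (pp. 606–607)] -/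
theorem isMonHom_id_pow [IsCommMonObj G] (n : ℕ) : IsMonHom ((𝟙 G) ^ n) := by
  induction n with
  | zero => rw [pow_zero, Hom.one_def]; infer_instance
  | succ n ih =>
    rw [pow_succ]
    haveI := ih
    exact isMonHom_mul G _ _

end Comap

/-! ## §2 The transpose is multiplicative for convolution -/

section Transpose

variable {G₁ G₂ : SchemeOver R}
  [GrpObj G₁] [IsCommMonObj G₁] [IsAffine G₁.left] [Module.Free R (Alg G₁)] [Module.Finite R (Alg G₁)]
  [GrpObj G₂] [IsCommMonObj G₂] [IsAffine G₂.left] [Module.Free R (Alg G₂)] [Module.Finite R (Alg G₂)]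
  (f g : G₁ ⟶ G₂) [IsMonHom f] [IsMonHom g] [IsMonHom (f * g)]

omit [Module.Free R (Alg G₂)] [Module.Finite R (Alg G₂)] in
/-- The product in `Γ(G)^*` is convolution of linear forms: `(α·β)(a) = (α ⊗ β)(Δ a)` read through ★ `evalTwo`. [cite: Tate1997FiniteFlatGroupSchemes, §(3.8) p. 145] -/
theorem DualAlg.ofConv_mul_apply (α β : DualAlg G₂) (a : Alg G₂) :
    WithConv.ofConv (α * β) a = FiniteDual.evalTwo R (Alg G₂) (α ⊗ₜ β) (Coalgebra.comul (R := R) a) := by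
  change (LinearMap.mul' R R ∘ₗ TensorProduct.map (WithConv.ofConv α) (WithConv.ofConv β) ∘ₗ Coalgebra.comul) a = _
  rw [LinearMap.comp_apply, LinearMap.comp_apply]
  induction (Coalgebra.comul (R := R) a) using TensorProduct.induction_on with
  | zero => rw [map_zero, map_zero, map_zero]
  | tmul x y => rw [TensorProduct.map_tmul, LinearMap.mul'_apply, FiniteDual.evalTwo_tmul]
  | add s t hs ht => simp only [map_add, hs, ht]

omit [Module.Free R (Alg G₂)] [Module.Finite R (Alg G₂)] in
/-- **`(Γ(f·g))^* = (Γ(f))^* ⋆ (Γ(g))^*`** in the convolution monoid `WithConv (Γ(G₁)^* →ₐ[R] Γ(G₂)^*)`: evaluated at `ν ∈ Γ(G₁)^*` and `a ∈ Γ(G₂)` both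
sides are `ν(Σ f^*(a₁)·g^*(a₂))` — the left by §1 (`Γ(f·g) = Γ(f) ⋆ Γ(g)`), the right because `Δ^*(ν) = ν ∘ m` (★ `evalTwo_comul_eq`) and the product
of `Γ(G₂)^*` is convolution (`DualAlg.ofConv_mul_apply`). [cite: Tate1997FiniteFlatGroupSchemes, §(3.8) p. 145] -/
theorem DualAlg.transpose_mul :
    DualAlg.transpose (f * g) = ((toConv (DualAlg.transpose f) : WithConv (DualAlg G₁ →ₐ[R] DualAlg G₂)) * toConv (DualAlg.transpose g)).ofConv := by
  apply AlgHom.ext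
  intro ν
  apply WithConv.ofConv_injective
  apply LinearMap.ext
  intro a
  -- left: `ν (Γ(f·g) a) = ν (m (Γ(f) ⊗ Γ(g)) (Δ a))`
  rw [DualAlg.transpose_apply_apply, Alg.comap_mul G₂ f g, AlgHom.convMul_apply]
  change WithConv.ofConv ν (Algebra.TensorProduct.lift (Alg.comap f) (Alg.comap g) (fun _ _ => Commute.all _ _) (Coalgebra.comul (R := R) a)) = _
  -- right: unfold the convolution of the transposes at `ν`, then the product of `Γ(G₂)^*` at `a`
  rw [AlgHom.convMul_apply]
  change _ = WithConv.ofConv (Algebra.TensorProduct.lift (DualAlg.transpose f) (DualAlg.transpose g) (fun _ _ => Commute.all _ _)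
    (Coalgebra.comul (R := R) ν)) a
  -- reduce the right-hand side to `evalTwo (Δ^* ν) ((Γ(f) ⊗ Γ(g)) (Δ a))`
  have key : ∀ z : DualAlg G₁ ⊗[R] DualAlg G₁,
      WithConv.ofConv (Algebra.TensorProduct.lift (DualAlg.transpose f) (DualAlg.transpose g) (fun _ _ => Commute.all _ _) z) a =
        FiniteDual.evalTwo R (Alg G₁) z (TensorProduct.map (Alg.comap f).toLinearMap (Alg.comap g).toLinearMap (Coalgebra.comul (R := R) a)) := by
    intro z
    induction z using TensorProduct.induction_on with
    | zero => rw [map_zero, map_zero, WithConv.ofConv_zero, LinearMap.zero_apply, LinearMap.zero_apply]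
    | tmul s t =>
      rw [Algebra.TensorProduct.lift_tmul, DualAlg.ofConv_mul_apply]
      induction (Coalgebra.comul (R := R) a) using TensorProduct.induction_on with
      | zero => rw [map_zero, map_zero, map_zero]
      | tmul x y =>
        rw [FiniteDual.evalTwo_tmul, TensorProduct.map_tmul, FiniteDual.evalTwo_tmul]
        change WithConv.ofConv (DualAlg.transpose f s) x * WithConv.ofConv (DualAlg.transpose g t) y = _
        rw [DualAlg.transpose_apply_apply, DualAlg.transpose_apply_apply]
        rfl
      | add p q hp hq => simp only [map_add, hp, hq]
    | add p q hp hq =>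
      have hadd : ∀ x y : DualAlg G₂, WithConv.ofConv (x + y) a = WithConv.ofConv x a + WithConv.ofConv y a := fun _ _ => rfl
      rw [map_add, hadd, hp, hq, map_add, LinearMap.add_apply]
  rw [key, show (Coalgebra.comul (R := R) ν : DualAlg G₁ ⊗[R] DualAlg G₁) = FiniteDual.comul R (Alg G₁) ν from rfl, FiniteDual.evalTwo_comul_eq,
    LinearMap.comp_apply]
  -- left: `ν (lift Γ(f) Γ(g) (Δ a)) = ν (m ((Γ(f) ⊗ Γ(g)) (Δ a)))`
  congr 1
  induction (Coalgebra.comul (R := R) a) using TensorProduct.induction_on with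
  | zero => rw [map_zero, map_zero, map_zero]
  | tmul x y => rw [Algebra.TensorProduct.lift_tmul, TensorProduct.map_tmul, LinearMap.mul'_apply]; rfl
  | add p q hp hq => simp only [map_add, hp, hq]

/-! ## §3 HEAD: `(f·g)^D = f^D·g^D`; `G` is killed by `n` iff `G^D` is -/

omit [Module.Free R (Alg G₂)] [Module.Finite R (Alg G₂)] in
/-- **HEAD — CARTIER DUALITY IS ADDITIVE: `(f·g)^D = f^D · g^D`** in the group `Hom(G₂^D, G₁^D)` (★ `coord_injective`: the coordinates of `(f·g)^D` are
`e⁻¹ ∘ (Γ(f·g))^* = e⁻¹ ∘ ((Γ f)^* ⋆ (Γ g)^*)` (§2), those of `f^D · g^D` are `(e⁻¹ ∘ (Γ f)^*) ⋆ (e⁻¹ ∘ (Γ g)^*)` (★ `coord_mul_eq`), and post-composition with an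
algebra map distributes over convolution, Mathlib `AlgHom.comp_convMul_distrib`). [cite: Tate1997FiniteFlatGroupSchemes, §(3.8) p. 145] -/
theorem cartierDualMap_mul : cartierDualMap (f * g) = cartierDualMap f * cartierDualMap g := by
  apply coord_injective
  have hD : ∀ (h : G₁ ⟶ G₂) [IsMonHom h], coord (cartierDualMap h) = (coord (𝟙 (cartierDual G₂))).comp (DualAlg.transpose h) := by
    intro h _
    rw [← coord_comp_cartierDualMap, Category.id_comp]
  have hmul : coord (cartierDualMap f * cartierDualMap g) =
      ((toConv (coord (cartierDualMap f)) : WithConv (DualAlg G₁ →ₐ[R] Alg (cartierDual G₂))) * toConv (coord (cartierDualMap g))).ofConv :=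
    coord_mul_eq R (DualAlg G₁) (T := cartierDual G₂) (cartierDualMap f) (cartierDualMap g)
  rw [hmul, hD (f * g), hD f, hD g, DualAlg.transpose_mul, AlgHom.comp_convMul_distrib, toConv_ofConv]

end Transpose

section Power

variable (G : SchemeOver R) [GrpObj G] [IsCommMonObj G] [IsAffine G.left] [Module.Free R (Alg G)] [Module.Finite R (Alg G)]

omit [Module.Free R (Alg G)] [Module.Finite R (Alg G)] in
/-- `cartierDualMap` does not depend on the `IsMonHom` witness (a local copy of ★ `cartierDualMap_congr`, whose file is not imported here).
[cite: Tate1997FiniteFlatGroupSchemes, §(3.8) p. 145] -/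
private theorem cartierDualMap_congr_local {G' : SchemeOver R} [GrpObj G'] [IsCommMonObj G'] [IsAffine G'.left] {f g : G' ⟶ G}
    [IsMonHom f] [IsMonHom g] (h : f = g) : cartierDualMap f = cartierDualMap g := by
  subst h
  rfl

/-- **`((𝟙 G)^n)^D = (𝟙 G^D)^n`**: the Cartier dual of the `n`-th power map of `G` is the `n`-th power map of `G^D` (§3 HEAD by induction, ★ `cartierDualMap_id`,
★ `cartierDualMap_of_eq_one`; the `IsMonHom` witness on `(𝟙 G)^n` is any, e.g. §1 `isMonHom_id_pow`). [cite: Tate1997FiniteFlatGroupSchemes, §(3.8) p. 145] -/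
theorem cartierDualMap_id_pow : ∀ (n : ℕ) [IsMonHom ((𝟙 G) ^ n)], cartierDualMap ((𝟙 G) ^ n) = (𝟙 (cartierDual G)) ^ n
  | 0, _ => by rw [cartierDualMap_of_eq_one ((𝟙 G) ^ 0) (pow_zero _), pow_zero]
  | n + 1, _ => by
    haveI : IsMonHom ((𝟙 G) ^ n) := isMonHom_id_pow G n
    haveI : IsMonHom ((𝟙 G) ^ n * 𝟙 G) := isMonHom_mul G _ _
    rw [cartierDualMap_congr_local G (pow_succ (𝟙 G) n), cartierDualMap_mul, cartierDualMap_id_pow n, cartierDualMap_id, pow_succ]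

/-- **`G` IS KILLED BY `n` IFF `G^D` IS: `(𝟙 G^D)^n = 1 ↔ (𝟙 G)^n = 1`** (`→`: dualise once more and transport along the biduality `ε_G : (G^D)^D ≅ G`, a
homomorphism — ★ `eq_cartierDualBidualIso_inv_comp_comp_hom`; `←`: `cartierDualMap_id_pow` and `1^D = 1`, ★ `cartierDualMap_of_eq_one`).
[cite: Tate1997FiniteFlatGroupSchemes, §(3.8) p. 145] -/
theorem id_pow_cartierDual_eq_one_iff (n : ℕ) : (𝟙 (cartierDual G)) ^ n = 1 ↔ (𝟙 G) ^ n = 1 := by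
  haveI := isMonHom_id_pow G n
  haveI := isMonHom_id_pow (cartierDual G) n
  constructor
  · intro h
    haveI := isMonHom_cartierDualBidualIso_hom G
    have h1 : cartierDualMap (cartierDualMap ((𝟙 G) ^ n)) = 1 := by
      rw [cartierDualMap_congr_local (cartierDual G) (cartierDualMap_id_pow G n)]
      exact cartierDualMap_of_eq_one _ h
    rw [eq_cartierDualBidualIso_inv_comp_comp_hom ((𝟙 G) ^ n), h1, MonObj.one_comp, MonObj.comp_one]
  · intro h
    rw [← cartierDualMap_id_pow G n]
    exact cartierDualMap_of_eq_one _ h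

end Power

/-! ## §4 The dual of a ring action: `a ↦ ι(a)^D` satisfies the ring-action laws on `G^D` -/

section DualAction

variable (G : SchemeOver R) [GrpObj G] [IsCommMonObj G] [IsAffine G.left] [Module.Free R (Alg G)] [Module.Finite R (Alg G)]
  {O : Type*} [CommRing O] (ι' : O → (G ⟶ G)) [∀ a, IsMonHom (ι' a)]

/-- **ADDITIVITY of the dual action**: if `ι(a + b) = ι(a)·ι(b)` then `ι(a + b)^D = ι(a)^D · ι(b)^D` (§3 HEAD). [cite: Tate1997FiniteFlatGroupSchemes, §(3.8) p. 145] -/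
theorem cartierDualMap_action_add (hadd : ∀ a b, ι' (a + b) = ι' a * ι' b) (a b : O) :
    cartierDualMap (ι' (a + b)) = cartierDualMap (ι' a) * cartierDualMap (ι' b) := by
  haveI : IsMonHom (ι' a * ι' b) := isMonHom_mul G _ _
  rw [cartierDualMap_congr_local G (hadd a b), cartierDualMap_mul]

omit [Module.Free R (Alg G)] [Module.Finite R (Alg G)] in
/-- **MULTIPLICATIVITY of the dual action** (for commutative `O` the contravariance `(ι(a) ≫ ι(b))^D = ι(b)^D ≫ ι(a)^D` is harmless):
if `ι(a·b) = ι(a) ≫ ι(b)` then `ι(a·b)^D = ι(a)^D ≫ ι(b)^D` (★ `cartierDualMap_comp`). [cite: Tate1997FiniteFlatGroupSchemes, §(3.8) p. 145] -/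
theorem cartierDualMap_action_mul (hmul : ∀ a b, ι' (a * b) = ι' a ≫ ι' b) (a b : O) :
    cartierDualMap (ι' (a * b)) = cartierDualMap (ι' a) ≫ cartierDualMap (ι' b) := by
  rw [cartierDualMap_congr_local G ((mul_comm a b).symm ▸ hmul b a : ι' (a * b) = ι' b ≫ ι' a), cartierDualMap_comp]

omit [Module.Free R (Alg G)] [Module.Finite R (Alg G)] in
/-- **UNIT**: if `ι(1) = 𝟙` then `ι(1)^D = 𝟙` (★ `cartierDualMap_id`). [cite: Tate1997FiniteFlatGroupSchemes, §(3.8) p. 145] -/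
theorem cartierDualMap_action_one (hone : ι' 1 = 𝟙 G) : cartierDualMap (ι' 1) = 𝟙 (cartierDual G) := by
  rw [cartierDualMap_congr_local G hone, cartierDualMap_id]

/-- **ZERO**: if `ι(0) = 1` (the trivial homomorphism) then `ι(0)^D = 1` (★ `cartierDualMap_of_eq_one`). [cite: Tate1997FiniteFlatGroupSchemes, §(3.8) p. 145] -/
theorem cartierDualMap_action_zero (hzero : ι' 0 = 1) : cartierDualMap (ι' 0) = 1 :=
  cartierDualMap_of_eq_one _ hzero

/-- **TORSION under the dual action**: if `ι(a) = 1` (`a` kills `G`) then `ι(a)^D = 1` (`a` kills `G^D`), and conversely (faithfulness ★ `cartierDualMap_injective`,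
★ `cartierDualMap_one`-type rewriting through `cartierDualMap_of_eq_one`). [cite: Tate1997FiniteFlatGroupSchemes, §(3.8) p. 145] -/
theorem cartierDualMap_action_eq_one_iff {O : Type*} (ι' : O → (G ⟶ G)) [∀ a, IsMonHom (ι' a)] (a : O) :
    cartierDualMap (ι' a) = 1 ↔ ι' a = 1 := by
  constructor
  · intro h
    haveI : IsMonHom (1 : G ⟶ G) := by rw [Hom.one_def]; infer_instance
    exact cartierDualMap_injective (ι' a) 1 (h.trans (cartierDualMap_of_eq_one (1 : G ⟶ G) rfl).symm)
  · exact cartierDualMap_of_eq_one _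

end DualAction

end AffineGroupScheme

end Literature.AlgebraicGeometry.GroupSchemes

end
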